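import Literature.Algebra.Lie.SpecialLinearJordanLefschetzPair
import HarnessLib

/-!
# `(𝔰𝔩(p+q), h)` with unequal blocks `p ≠ q` is NOT a Lefschetz pair: `h` is not a simple element (Looijenga–Lunts 1997, proof of (2.6), type `A_l`)

Topic `Literature/Algebra/Lie` (namespace `Literature.Algebra.Lie.SpecialLinearUnequalBlocks`).  Lane `lit-hodgefound`
(Track 2 foundations library), skeleton seat `lit-hodgefound-skel-1` (generation 51), row **A1-201** of
`run/shared/lean/pub/lit-hodgefound/SKELETON.md`; the NEGATIVE companion of row A1-191
(`SpecialLinearJordanLefschetzPair.lean`: for EQUAL blocks `(𝔰𝔩(2m), h)` is the Jordan–Lefschetz pair of type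
`(A_{2m-1}, A_{m-1}+A_{m-1})`), in the same way as row A1-192's odd-`n` half is the negative companion of its even half.
THEOREMS ONLY (no definition, no named fact, no `sorry`; net debt `0`).

Carrier: Mathlib's `LieAlgebra.SpecialLinear.sl (p ⊕ q) K` in block form with RECTANGULAR off-diagonal blocks, and the
traceless grading element of the splitting `V = V_{-1} ⊕ V_1`, `dim V_{-1} = |p|`, `dim V_1 = |q|`:
`h = (a·1_p 0; 0 b·1_q)`, `a = 2|q|/(|p|+|q|)`, `b = -2|p|/(|p|+|q|)` (so `a - b = 2`, `|p|a + |q|b = 0`, and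
`a + b = 2(|q|-|p|)/(|p|+|q|) ≠ 0` exactly when `|p| ≠ |q|`).

## Source, VERBATIM

E. Looijenga, V. A. Lunts, *A Lie algebra attached to a projective variety*, Invent. Math. **129** (1997) 361–412 (held
TeX `paper:arxiv-alg-geom_9604014`), §2, proof of (2.6), p0010 L32–L41: "The pairs `(B, β)` with the property of the
previous lemma are those in this list plus the following: in case `A_l` we can take `l` and `β` arbitrary, in case
`D_{2l+1}` any end of the Dynkin diagram, and `B` of type `E_6` with `β` the end of the branch of length `3`. These
addional possibilities disappear if we want `h` to be a simple element (that is, `h = [e, f]` for certain `e ∈ 𝔤_2` and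
`f ∈ 𝔤_{-2}`): for the classical cases `A_l` and `D_{2l+1}` this follows from the discussion following 1.16)"; (2.9)
p0010 L82–L93 (Case `(A_{2m-1}, A_{m-1}+A_{m-1})`: "`V = V_{-1} ⊕ V_1` a direct sum decomposition into subspaces of
dimension `m` … `h ∈ 𝔰𝔩(V)` be `±1` on `V_{±1}` … `𝔤_2 ≅ Hom(V_{-1}, V_1)`"); §1 p0007 L54–L56 ("a semisimple element
`h` of `𝔤` … `h` is simple").

## Contents (all proved)

* §1 block calculus on `p ⊕ q`: `trace_fromBlocks_rect` (private), `scalarBlocks_mul_sub_mul` (`[h_{a,b}, (A B; C D)] =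
  (0 (a-b)B; (b-a)C 0)`), `upper_mul_sub_mul_lower_rect` (`[(0 B; 0 0), (0 0; C 0)] = (BC 0; 0 -CB)`).
* §2 `scalarBlocks_mem_sl_iff`; **`exists_eq_upper_of_bracket_eq_two_smul`** / **`exists_eq_lower_of_bracket_eq_neg_two_smul`**
  (`𝔤_{±2}(h_{a,b})` are the off-diagonal blocks, `a - b = 2`, `2 ≠ 0`); **`eq_zero_of_bracket_eq_scalarBlocks`**: an
  `𝔰𝔩₂`-triple `(e, h_{a,b}, f)` with `a + b ≠ 0` forces `a = 0` — `BC = a·1`, `CB = -b·1` give `aB = BCB = -bB`, so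
  `B = 0`.
* §3 (characteristic `0`) `gradingElement_mem_sl`, `lie_eq_zero_of_mem_adDegree_two` (`𝔤_2` abelian),
  **`not_isSimpleElement_sl_of_card_ne`**: for `|p| ≠ |q|` (both non-empty) `h` is NOT a simple element of `𝔰𝔩(p+q, K)`;
  **`not_isLefschetzPair_sl_of_card_ne`**, `not_isJordanLefschetzPair_sl_of_card_ne`.

## Scope

Only the negative statement for `|p| ≠ |q|` and the abelianness of `𝔤_2`; the positive case `|p| = |q|` is row A1-191;
the analogous `D_{2l+1}`/`E_6` exclusions: row A1-192 §5 (`D`, odd `n`) resp. not treated (`E_6`).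
-/

namespace Literature.Algebra.Lie.SpecialLinearUnequalBlocks

open LieAlgebra LieAlgebra.SpecialLinear Matrix Sum Literature.Algebra.Lie
open Literature.Algebra.Lie.SpecialLinearJordanLefschetzPair

variable {p q : Type*} [Fintype p] [DecidableEq p] [Fintype q] [DecidableEq q] {R : Type*} [CommRing R]
  {K : Type*} [Field K]

/-! ### §1 Block calculus on `p ⊕ q` (rectangular off-diagonal blocks) -/

omit [DecidableEq p] [DecidableEq q] in
/-- `tr (A B; C D) = tr A + tr D` (blocks of sizes `p`, `q`). [folklore] -/
private theorem trace_fromBlocks_rect (A : Matrix p p R) (B : Matrix p q R) (C : Matrix q p R) (D : Matrix q q R) :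
    (fromBlocks A B C D).trace = A.trace + D.trace := by
  simp [Matrix.trace, Fintype.sum_sum_type]

/-- `[(a 0; 0 b), (A B; C D)] = (0 (a-b)B; (b-a)C 0)` for the scalar blocks `a·1_p`, `b·1_q`.
[cite: LooijengaLunts1997, §2 (2.9) p. 10 L82–L93 (Case (A_{2m-1}, A_{m-1}+A_{m-1}): "h ∈ 𝔰𝔩(V) be ±1 on V_{±1}")] -/
theorem scalarBlocks_mul_sub_mul (a b : R) (A : Matrix p p R) (B : Matrix p q R) (C : Matrix q p R) (D : Matrix q q R) :
    fromBlocks (a • (1 : Matrix p p R)) 0 0 (b • (1 : Matrix q q R)) * fromBlocks A B C D -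
        fromBlocks A B C D * fromBlocks (a • (1 : Matrix p p R)) 0 0 (b • (1 : Matrix q q R)) =
      fromBlocks 0 ((a - b) • B) ((b - a) • C) 0 := by
  rw [fromBlocks_multiply, fromBlocks_multiply, sub_eq_add_neg, fromBlocks_neg, fromBlocks_add]
  simp only [Matrix.smul_mul, Matrix.mul_smul, Matrix.one_mul, Matrix.mul_one, Matrix.zero_mul, Matrix.mul_zero,
    add_zero, zero_add, add_neg_cancel]
  congr 1 <;> module

/-- `[(0 B; 0 0), (0 0; C 0)] = (BC 0; 0 -CB)` with rectangular `B : p × q`, `C : q × p`.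
[cite: LooijengaLunts1997, §2 (2.9) p. 10 L82–L93] -/
theorem upper_mul_sub_mul_lower_rect (B : Matrix p q R) (C : Matrix q p R) :
    fromBlocks (0 : Matrix p p R) B 0 (0 : Matrix q q R) * fromBlocks (0 : Matrix p p R) 0 C (0 : Matrix q q R) -
        fromBlocks (0 : Matrix p p R) 0 C (0 : Matrix q q R) * fromBlocks (0 : Matrix p p R) B 0 (0 : Matrix q q R) =
      fromBlocks (B * C) 0 0 (-(C * B)) := by
  rw [fromBlocks_multiply, fromBlocks_multiply, sub_eq_add_neg, fromBlocks_neg, fromBlocks_add]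
  simp

/-! ### §2 The grading element `h_{a,b} = (a·1_p 0; 0 b·1_q)` of `𝔰𝔩(p+q)`, `a - b = 2` -/

/-- `h_{a,b} ∈ 𝔰𝔩(p+q, R)` iff `|p|a + |q|b = 0`. [cite: LooijengaLunts1997, §2 (2.9) p. 10 L82–L93; §2 (2.6) proof p. 10 L32–L41 ("in case A_l we can take l and β arbitrary")] -/
theorem scalarBlocks_mem_sl_iff (a b : R) :
    fromBlocks (a • (1 : Matrix p p R)) 0 0 (b • (1 : Matrix q q R)) ∈ sl (p ⊕ q) R ↔
      (Fintype.card p : R) * a + (Fintype.card q : R) * b = 0 := by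
  rw [mem_sl_iff, trace_fromBlocks_rect, trace_smul, trace_smul, trace_one, trace_one, smul_eq_mul, smul_eq_mul,
    mul_comm a, mul_comm b]

/-- **`𝔤_2(h_{a,b}) = (0 B; 0 0) ≅ Hom(V_1, V_{-1})`**: `[h, e] = 2e` forces `e = (0 B; 0 0)` (`a - b = 2`, `2 ≠ 0`).
[cite: LooijengaLunts1997, §2 (2.9) p. 10 L82–L93 ("𝔤_2 ≅ Hom(V_{-1}, V_1) resp. 𝔤_{-2} ≅ Hom(V_1, V_{-1})")] -/
theorem exists_eq_upper_of_bracket_eq_two_smul (h2 : (2 : K) ≠ 0) {a b : K} (hab : a - b = 2)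
    {e : Matrix (p ⊕ q) (p ⊕ q) K}
    (he : fromBlocks (a • (1 : Matrix p p K)) 0 0 (b • (1 : Matrix q q K)) * e -
      e * fromBlocks (a • (1 : Matrix p p K)) 0 0 (b • (1 : Matrix q q K)) = (2 : K) • e) :
    ∃ B : Matrix p q K, e = fromBlocks 0 B 0 0 := by
  have h4 : (4 : K) ≠ 0 := by
    rw [show (4 : K) = 2 * 2 by norm_num]; exact mul_ne_zero h2 h2
  have hba : b - a = -2 := by linear_combination -hab
  rw [← fromBlocks_toBlocks e, scalarBlocks_mul_sub_mul, fromBlocks_smul, fromBlocks_inj, hab, hba] at he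
  obtain ⟨h₁, -, h₃, h₄⟩ := he
  refine ⟨e.toBlocks₁₂, ?_⟩
  conv_lhs => rw [← fromBlocks_toBlocks e]
  have e₁ : e.toBlocks₁₁ = 0 := by
    have := h₁.symm; rwa [smul_eq_zero, or_iff_right h2] at this
  have e₃ : e.toBlocks₂₁ = 0 := by
    have : (4 : K) • e.toBlocks₂₁ = 0 := by
      rw [show (4 : K) = 2 - -2 by norm_num, sub_smul, h₃, sub_self]
    rwa [smul_eq_zero, or_iff_right h4] at this
  have e₄ : e.toBlocks₂₂ = 0 := by
    have := h₄.symm; rwa [smul_eq_zero, or_iff_right h2] at this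
  rw [e₁, e₃, e₄]

/-- **`𝔤_{-2}(h_{a,b}) = (0 0; C 0)`**: `[h, f] = -2f` forces `f = (0 0; C 0)`. [cite: LooijengaLunts1997, §2 (2.9) p. 10 L82–L93] -/
theorem exists_eq_lower_of_bracket_eq_neg_two_smul (h2 : (2 : K) ≠ 0) {a b : K} (hab : a - b = 2)
    {f : Matrix (p ⊕ q) (p ⊕ q) K}
    (hf : fromBlocks (a • (1 : Matrix p p K)) 0 0 (b • (1 : Matrix q q K)) * f -
      f * fromBlocks (a • (1 : Matrix p p K)) 0 0 (b • (1 : Matrix q q K)) = -((2 : K) • f)) :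
    ∃ C : Matrix q p K, f = fromBlocks 0 0 C 0 := by
  have h4 : (4 : K) ≠ 0 := by
    rw [show (4 : K) = 2 * 2 by norm_num]; exact mul_ne_zero h2 h2
  have hba : b - a = -2 := by linear_combination -hab
  rw [← fromBlocks_toBlocks f, scalarBlocks_mul_sub_mul, fromBlocks_smul, fromBlocks_neg, fromBlocks_inj, hab,
    hba] at hf
  obtain ⟨h₁, h₂, -, h₄⟩ := hf
  refine ⟨f.toBlocks₂₁, ?_⟩
  conv_lhs => rw [← fromBlocks_toBlocks f]
  have e₁ : f.toBlocks₁₁ = 0 := by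
    have := h₁.symm; rwa [neg_eq_zero, smul_eq_zero, or_iff_right h2] at this
  have e₂ : f.toBlocks₁₂ = 0 := by
    have : (4 : K) • f.toBlocks₁₂ = 0 := by
      rw [show (4 : K) = 2 + 2 by norm_num, add_smul]; nth_rw 1 [h₂]; rw [neg_add_cancel]
    rwa [smul_eq_zero, or_iff_right h4] at this
  have e₄ : f.toBlocks₂₂ = 0 := by
    have h₄' := h₄.symm
    rwa [neg_eq_zero, smul_eq_zero, or_iff_right h2] at h₄'
  rw [e₁, e₂, e₄]

/-- **No `𝔰𝔩₂`-triple through `h_{a,b}` when `a + b ≠ 0`** (matrix form): if `e, f ∈ 𝔤𝔩(p+q)` satisfy `[h, e] = 2e`,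
`[h, f] = -2f` and `[e, f] = h_{a,b}` with `a - b = 2`, `a + b ≠ 0`, `2 ≠ 0` and `p ≠ ∅`, then `a = 0`: indeed
`e = (0 B; 0 0)`, `f = (0 0; C 0)`, `BC = a·1`, `CB = -b·1`, so `aB = BCB = -bB`, `(a + b)B = 0`, `B = 0`, `a·1_p = 0`.
[cite: LooijengaLunts1997, §2 (2.6) proof p. 10 L36–L41 ("These addional possibilities disappear if we want h to be a simple element (that is, h = [e, f] for certain e ∈ 𝔤_2 and f ∈ 𝔤_{-2}): for the classical cases A_l … this follows from the discussion following 1.16")] -/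
theorem eq_zero_of_bracket_eq_scalarBlocks [Nonempty p] (h2 : (2 : K) ≠ 0) {a b : K} (hab : a - b = 2)
    (hab' : a + b ≠ 0) {e f : Matrix (p ⊕ q) (p ⊕ q) K}
    (he : fromBlocks (a • (1 : Matrix p p K)) 0 0 (b • (1 : Matrix q q K)) * e -
      e * fromBlocks (a • (1 : Matrix p p K)) 0 0 (b • (1 : Matrix q q K)) = (2 : K) • e)
    (hf : fromBlocks (a • (1 : Matrix p p K)) 0 0 (b • (1 : Matrix q q K)) * f -
      f * fromBlocks (a • (1 : Matrix p p K)) 0 0 (b • (1 : Matrix q q K)) = -((2 : K) • f))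
    (hef : e * f - f * e = fromBlocks (a • (1 : Matrix p p K)) 0 0 (b • (1 : Matrix q q K))) : a = 0 := by
  obtain ⟨B, rfl⟩ := exists_eq_upper_of_bracket_eq_two_smul h2 hab he
  obtain ⟨C, rfl⟩ := exists_eq_lower_of_bracket_eq_neg_two_smul h2 hab hf
  -- `BC = a·1`, `CB = -b·1`
  rw [upper_mul_sub_mul_lower_rect, fromBlocks_inj] at hef
  obtain ⟨hBC, -, -, hCB⟩ := hef
  have hCB' : C * B = -(b • (1 : Matrix q q K)) := by rw [← hCB, neg_neg]
  -- `(a + b) B = 0`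
  have hB : (a + b) • B = 0 := by
    have h1 : B * C * B = a • B := by rw [hBC, Matrix.smul_mul, Matrix.one_mul]
    have h2' : B * C * B = -(b • B) := by rw [Matrix.mul_assoc, hCB', Matrix.mul_neg, Matrix.mul_smul, Matrix.mul_one]
    rw [add_smul, ← h1, h2', neg_add_cancel]
  rw [smul_eq_zero, or_iff_right hab'] at hB
  -- so `a·1_p = BC = 0`
  rw [hB, Matrix.zero_mul] at hBC
  obtain ⟨i⟩ := ‹Nonempty p›
  have := congrFun (congrFun hBC i) i
  simpa using this.symm

/-! ### §3 `(𝔰𝔩(p+q), h)` for `|p| ≠ |q|`: degrees `-2, 0, 2`, but `h` is NOT simple -/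

section Main

variable [CharZero K]

/-- The traceless grading element of the splitting `V = V_{-1} ⊕ V_1`, `dim V_{-1} = |p|`, `dim V_1 = |q|`:
`h = (a·1_p 0; 0 b·1_q)` with `a = 2|q|/(|p|+|q|)`, `b = -2|p|/(|p|+|q|)` (`a - b = 2`), lies in `𝔰𝔩(p+q, K)`.
[cite: LooijengaLunts1997, §2 (2.6) proof p. 10 L32–L41 ("in case A_l we can take l and β arbitrary"), (2.9) p. 10 L82–L93] -/
theorem gradingElement_mem_sl [Nonempty p] :
    fromBlocks (((2 : K) * Fintype.card q / (Fintype.card p + Fintype.card q)) • (1 : Matrix p p K)) 0 0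
        ((-(2 : K) * Fintype.card p / (Fintype.card p + Fintype.card q)) • (1 : Matrix q q K)) ∈ sl (p ⊕ q) K := by
  rw [scalarBlocks_mem_sl_iff]
  have hpq : ((Fintype.card p : K) + Fintype.card q) ≠ 0 := by
    have h : Fintype.card p + Fintype.card q ≠ 0 := by have := Fintype.card_pos (α := p); omega
    exact_mod_cast h
  field_simp
  ring

/-- `𝔤_2` of `(𝔰𝔩(p+q), h)` is abelian (`(0 B; 0 0)(0 B'; 0 0) = 0`): the pair satisfies every clause of a
Jordan–Lefschetz pair except the existence of a Lefschetz element (when `|p| ≠ |q|`).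
[cite: LooijengaLunts1997, §2 (2.6) proof p. 10 L32–L41 ("The pairs (B, β) with the property of the previous lemma are those in this list plus the following: in case A_l we can take l and β arbitrary")] -/
theorem lie_eq_zero_of_mem_adDegree_two [Nonempty p] {x y : sl (p ⊕ q) K}
    (hx : x ∈ adDegree K (⟨fromBlocks (((2 : K) * Fintype.card q / (Fintype.card p + Fintype.card q)) •
        (1 : Matrix p p K)) 0 0 ((-(2 : K) * Fintype.card p / (Fintype.card p + Fintype.card q)) • (1 : Matrix q q K)),
      gradingElement_mem_sl⟩ : sl (p ⊕ q) K) 2)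
    (hy : y ∈ adDegree K (⟨fromBlocks (((2 : K) * Fintype.card q / (Fintype.card p + Fintype.card q)) •
        (1 : Matrix p p K)) 0 0 ((-(2 : K) * Fintype.card p / (Fintype.card p + Fintype.card q)) • (1 : Matrix q q K)),
      gradingElement_mem_sl⟩ : sl (p ⊕ q) K) 2) :
    ⁅x, y⁆ = 0 := by
  have hpq' : ((Fintype.card p : K) + Fintype.card q) ≠ 0 := by
    have h : Fintype.card p + Fintype.card q ≠ 0 := by have := Fintype.card_pos (α := p); omega
    exact_mod_cast h
  have hab : (2 : K) * Fintype.card q / (Fintype.card p + Fintype.card q) -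
      -(2 : K) * Fintype.card p / (Fintype.card p + Fintype.card q) = 2 := by
    field_simp; ring
  have hx' := congrArg Subtype.val (mem_adDegree_iff.1 hx)
  have hy' := congrArg Subtype.val (mem_adDegree_iff.1 hy)
  rw [coe_lie_sl, SetLike.val_smul] at hx' hy'
  obtain ⟨B, hB⟩ := exists_eq_upper_of_bracket_eq_two_smul two_ne_zero hab hx'
  obtain ⟨B', hB'⟩ := exists_eq_upper_of_bracket_eq_two_smul two_ne_zero hab hy'
  apply Subtype.ext
  rw [coe_lie_sl, ZeroMemClass.coe_zero, hB, hB', fromBlocks_multiply, fromBlocks_multiply]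
  simp

/-- **(2.6), proof, type `A_l` with `β` NOT the middle node: `h` is not a simple element.**  For `|p| ≠ |q|` (both
non-empty) the grading element `h` of `𝔰𝔩(p+q, K)` attached to `V = V_{-1} ⊕ V_1` (`dim V_{-1} = |p| ≠ |q| = dim V_1`)
admits NO `𝔰𝔩₂`-triple `(e, h, f)` in `𝔰𝔩(p+q, K)` — although `ad h` has only the degrees `-2, 0, 2` — so
`(𝔰𝔩(p+q), h)` is not a Lefschetz pair; only `|p| = |q|` (row A1-191, type `(A_{2m-1}, A_{m-1}+A_{m-1})`) survives in
the list (2.6). [cite: LooijengaLunts1997, §2 (2.6) proof p. 10 L32–L41 ("The pairs (B, β) with the property of the previous lemma are those in this list plus the following: in case A_l we can take l and β arbitrary … These addional possibilities disappear if we want h to be a simple element")] -/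
theorem not_isSimpleElement_sl_of_card_ne [Nonempty p] [Nonempty q] (hpq : Fintype.card p ≠ Fintype.card q) :
    ¬IsSimpleElement (⟨fromBlocks (((2 : K) * Fintype.card q / (Fintype.card p + Fintype.card q)) • (1 : Matrix p p K))
        0 0 ((-(2 : K) * Fintype.card p / (Fintype.card p + Fintype.card q)) • (1 : Matrix q q K)),
      gradingElement_mem_sl⟩ : sl (p ⊕ q) K) := by
  rintro ⟨e, f, t⟩
  have hpq' : ((Fintype.card p : K) + Fintype.card q) ≠ 0 := by
    have h : Fintype.card p + Fintype.card q ≠ 0 := by have := Fintype.card_pos (α := p); omega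
    exact_mod_cast h
  set a : K := (2 : K) * Fintype.card q / (Fintype.card p + Fintype.card q) with ha
  set b : K := -(2 : K) * Fintype.card p / (Fintype.card p + Fintype.card q) with hb
  have hab : a - b = 2 := by rw [ha, hb]; field_simp; ring
  have hab' : a + b ≠ 0 := by
    rw [ha, hb, ← add_div, div_ne_zero_iff]
    refine ⟨?_, hpq'⟩
    rw [neg_mul, ← sub_eq_add_neg, ← mul_sub]
    exact mul_ne_zero two_ne_zero (sub_ne_zero.2 (by exact_mod_cast (Ne.symm hpq)))
  have haz : a ≠ 0 := by
    rw [ha]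
    exact div_ne_zero (mul_ne_zero two_ne_zero (by exact_mod_cast (Fintype.card_ne_zero (α := q)))) hpq'
  have he := congrArg Subtype.val t.lie_h_e_nsmul
  have hf := congrArg Subtype.val t.lie_h_f_nsmul
  have hef := congrArg Subtype.val t.lie_e_f
  rw [coe_lie_sl, ← Nat.cast_smul_eq_nsmul K, SetLike.val_smul, Nat.cast_ofNat] at he
  rw [coe_lie_sl, ← Nat.cast_smul_eq_nsmul K, NegMemClass.coe_neg, SetLike.val_smul, Nat.cast_ofNat] at hf
  rw [coe_lie_sl] at hef
  exact haz (eq_zero_of_bracket_eq_scalarBlocks two_ne_zero hab hab' he hf hef)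

/-- Hence `(𝔰𝔩(p+q, K), h)` is **not a Lefschetz pair** (and a fortiori not Jordan–Lefschetz) for `|p| ≠ |q|`.
[cite: LooijengaLunts1997, §2 (2.6) proof p. 10 L32–L41; §1 p. 7 L54–L56 ("a semisimple element h … simple")] -/
theorem not_isLefschetzPair_sl_of_card_ne [Nonempty p] [Nonempty q] (hpq : Fintype.card p ≠ Fintype.card q) :
    ¬IsLefschetzPair K (⟨fromBlocks (((2 : K) * Fintype.card q / (Fintype.card p + Fintype.card q)) •
        (1 : Matrix p p K)) 0 0 ((-(2 : K) * Fintype.card p / (Fintype.card p + Fintype.card q)) • (1 : Matrix q q K)),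
      gradingElement_mem_sl⟩ : sl (p ⊕ q) K) := by
  rintro ⟨𝔞, T⟩
  exact not_isSimpleElement_sl_of_card_ne hpq T.isSimpleElement

/-- … and not a Jordan–Lefschetz pair. [cite: LooijengaLunts1997, §2 (2.6) proof p. 10 L32–L41] -/
theorem not_isJordanLefschetzPair_sl_of_card_ne [Nonempty p] [Nonempty q] (hpq : Fintype.card p ≠ Fintype.card q) :
    ¬IsJordanLefschetzPair K (⟨fromBlocks (((2 : K) * Fintype.card q / (Fintype.card p + Fintype.card q)) •
        (1 : Matrix p p K)) 0 0 ((-(2 : K) * Fintype.card p / (Fintype.card p + Fintype.card q)) • (1 : Matrix q q K)),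
      gradingElement_mem_sl⟩ : sl (p ⊕ q) K) :=
  fun J ↦ not_isLefschetzPair_sl_of_card_ne hpq J.isLefschetzPair

end Main

end Literature.Algebra.Lie.SpecialLinearUnequalBlocks
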